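import Literature.AlgebraicGeometry.HodgeTheory.FermatClaimPermutationInvariance
import Literature.AlgebraicGeometry.HodgeTheory.FermatShiodaCondition
import Literature.AlgebraicGeometry.HodgeTheory.ShiodaClaimPairedProofs
import HarnessLib

/-!
# Aoki's Thm. 1-4 (ii) (pair cancellation): the tree's rendering versus the printed letter; dimension zero; Hodge bookkeeping

Family `hodge`, layer `Literature/AlgebraicGeometry/HodgeTheory`. PROOF FILE (sorry-free, no named
fact introduced; D-0026) for the named fact `Aoki1987_claim_of_claim_juxtaposition_paired` of
`FermatInductiveClaims` — Aoki, J. Math. Soc. Japan 39 (1987) 385–396, Thm. 1-4 (ii) (attributed to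
Shioda, Math. Ann. 245 (1979), and Ran, Compositio Math. 42 (1980)):

> "(ii) If there exists `δ ∈ 𝔇ₘ` such that claim(`α∗δ`) is true, then claim(`α`) is also true."
> (p. 388), `𝔇ⁿₘ = {α ∈ 𝔄ⁿₘ | α ∼ (a₀, -a₀, …, a_r, -a_r) for some a₀, …, a_r ∈ ℤ/m - {0}}`,
> "we write `α ∼ β` if `α` is equal to `β` up to permutation", `∗` the juxtaposition (pp. 386–387).

Companion proof files of the same fact file: `FermatClaimPermutationInvariance` (the symmetric group
acts on `Xⁿₘ`: `claim(α)` depends only on the multiset of values of `α`; the literal juxtaposition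
`FermatCharacter.append`; Thm. 1-4 (i) from its literal form), `FermatInductiveClaimsProofs`
(Thm. 2-1), `ShiodaClaimPairedProofs` (Thm. 1-1; `FermatCharacter.claim_zero`).

## What is proved here

* `FermatCharacter.pairs a = (a₀, …, a_t, -a₀, …, -a_t)` — **the literal paired characters of `𝔇ₘ`**
  (Aoki's `(a₀, -a₀, …, a_t, -a_t)` up to the evident permutation; `𝔇ₘ` is defined up to `∼`):
  `univ_val_map_pairs` (its multiset of values is that of `a` plus that of `-a`), `isPaired_pairs`
  (it IS paired: the involution `i ↦ i ± (t+1)`), `pairs_ne_zero`; and conversely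
  **`IsPaired.exists_pairs`: every paired character `δ` (`δ ∘ σ = -δ` for a fixed-point-free
  involution `σ`, the tree's `FermatCharacter.IsPaired`) is `∼ pairs a`** for some `a` — choose one
  index in each `σ`-orbit (`i < σ i`), so that `Fin (2t+2) ≃ S ⊕ S` with `δ = (δ|_S, -δ|_S)`.
* `Aoki1987_claim_of_claim_juxtaposition_paired_of_literal` and
  `Aoki1987_claim_of_claim_juxtaposition_paired.literal` — **the tree's rendering of Thm. 1-4 (ii)
  (juxtaposition and `𝔇ₘ` up to permutation, by multisets of values) is EQUIVALENT to its printed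
  letter** "claim(`α ∗ (a₀, -a₀, …, a_t, -a_t)`) ⟹ claim(`α`)" with the literal juxtaposition
  `FermatCharacter.append`: from the letter, a `γ ∼ α∗δ` with `δ ∼ pairs a` has
  `γ ∼ append α (pairs a)`, and claim depends only on the multiset of values (the tree's
  `FermatCharacter.Claim.of_univ_val_map_eq`: coordinate permutations are automorphisms of `Xⁿₘ`);
  the converse instantiates the rendering at `δ = pairs a`, `γ = append α (pairs a)`. The letter
  itself — Shioda's inductive structure read backwards — is NOT proved here (see below); this is the
  exact analogue, for part (ii), of the tree's `Aoki1987_claim_juxtaposition_of_append` for part (i).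
* `Aoki1987_claim_of_claim_juxtaposition_paired_dim_zero` — **dimension `0`**: the slice `r = 0` of
  the fact holds because on `X⁰ₘ` every class is algebraic (`algebraicClasses _ 0 = ⊤`; the tree's
  `FermatCharacter.claim_zero`).
* `FermatCharacter.IsHodge.of_map_eq_add`, `.of_map_eq_add_left/right`,
  `FermatCharacter.isHodge_of_juxtaposition_paired`, `FermatCharacter.claim_congr_of_map_eq` —
  bookkeeping in the multiset language of the facts: `α∗β ∈ 𝔅` iff `α, β ∈ 𝔅` (given one of
  them; the semigroup `Mₘ`, `isHodge_iff_isHodgeMultiset`), in the setting of (ii) `γ ∼ α∗δ` is a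
  Hodge character of `X^{2(r+t+1)}ₘ` (the standing hypothesis "`α ∈ 𝔅ʳₘ, β ∈ 𝔅ˢₘ`" of Thm. 1-4,
  under which `V(γ)` is an eigenLINE), and claim(α) ↔ claim(β) for `α ∼ β` (iff form of
  `Claim.of_univ_val_map_eq`).

## What is NOT here: the printed argument for the letter of (ii) and the layers it needs

Aoki prints no proof of Thm. 1-4 ("we can show the following theorem using inductive structure",
p. 387). The inductive structure is Shioda–Katsura, Tôhoku Math. J. 31 (1979) Thm. 1.7 (`X^{r+s}ₘ`
from `Xʳₘ × Xˢₘ`: blow up `X^{r-1}ₘ × X^{s-1}ₘ`, divide by `μₘ`, blow down) and, on cohomology,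
Shioda, Math. Ann. 245 Thm. I / da Silva, arXiv:2101.04739, Thm. 2.2: a `Gⁿₘ`-equivariant
isomorphism `f : [Hʳ_prim(Xʳ) ⊗ Hˢ_prim(Xˢ)]^{μₘ} ⊕ H^{r-1}_prim(X^{r-1}) ⊗ H^{s-1}_prim(X^{s-1}) ⥲ Hⁿ_prim(Xⁿ)`
preserving algebraic classes (indeed an isomorphism of Chow groups with `ℚ`-coefficients compatible
with the cycle class map, Shioda–Katsura §2 / Fulton's blow-up formula), with
`f(Z₁ ⊗ Z₂) = m · Z₁ ∧ Z₂` (ruled join; Ran §4: "`*` preserves algebraic cycles", Cor. 4.7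
`H_{χ'} * H_{χ''} = H_{χ'*χ''}`). Part (i) reads the second summand forwards; part (ii) must read it
backwards: a non-zero algebraic `ξ ∈ V(α∗δ)` (`dim V = 1`) is `f(v ⊗ w)`, `f⁻¹` keeps it algebraic
on `X^{2r} × X^{2t}`, and slicing against an algebraic `w' ∈ V(-δ)` (a linear subspace, Thm. 1-1)
with `⟨w, w'⟩ ≠ 0` gives `v ∈ V(α)` algebraic. On the tree's carriers (`complexBetti`,
support-defined `algebraicClasses`) this needs a CONSTRUCTED Gysin/cycle-class formalism (the tree
has the hypothesis structure `GysinFormalism` only), Künneth, the blow-up correspondence, and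
`dim V(α) = 1` (Ran Prop. 1.7) — the next layers, not lemmas of this file.

## References

* [Aoki1987] N. Aoki, Some new algebraic cycles on Fermat varieties, J. Math. Soc. Japan 39 (1987)
  385–396: p. 386 (claim, `𝔇ⁿₘ`, "α ∼ β"), p. 387 (`∗`, Thm. 1-1), Thm. 1-4 (p. 388) (text read,
  J-STAGE copy).
* [ShiodaKatsura1979] T. Shioda, T. Katsura, On Fermat varieties, Tôhoku Math. J. 31 (1979) 97–115,
  Lemma 1.1, Thm. 1.7, Lemma 2.1–2.2, Prop. 2.4 (text read, J-STAGE copy).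
* [Shioda1979HodgeFermat] T. Shioda, The Hodge conjecture for Fermat varieties, Math. Ann. 245 (1979)
  175–184, Thm. I (Aoki's [4]; cite-only).
* [Ran1980] Z. Ran, Cycles on Fermat hypersurfaces, Compositio Math. 42 (1980) 121–142, §1 (1.8)
  (juxtaposition), §4 (p. 139), Prop. 4.6, Cor. 4.7 (text read, numdam).
* [daSilva2021HodgeFermat] G. da Silva Jr., Notes on the Hodge Conjecture for Fermat Varieties,
  arXiv:2101.04739, Thm. 2.2, Cor. 2.3 and conditions (P1)/(P2) ("∼ means equality up to
  permutation between factors") (text read).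
* [Shioda1979PJA] T. Shioda, Proc. Japan Acad. 55A (1979) 111–114, §1 (the semigroup `Mₘ`, elements
  of length `1`).
-/

noncomputable section

open Finset

namespace Literature.AlgebraicGeometry.HodgeTheory

namespace FermatCharacter

variable {m : ℕ}

/-! ### Hodge bookkeeping of juxtapositions (multiset form) -/

section Bookkeeping

variable {a b c : ℕ} {α : Fin a → ZMod m} {β : Fin b → ZMod m} {γ : Fin c → ZMod m}

/-- **A juxtaposition of Hodge characters is a Hodge character**: if the multiset of values of `γ`
is that of `α` plus that of `β` (`γ ∼ α∗β`) and `α ∈ 𝔅`, `β ∈ 𝔅`, then `γ ∈ 𝔅` (the semigroup `Mₘ`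
is closed under addition; lengths add). [cite: Shioda1979PJA, §1 (the semigroup Mₘ)]
[cite: Aoki1987, §1 p. 387 (juxtaposition `∗`)] -/
theorem IsHodge.of_map_eq_add (hα : IsHodge α) (hβ : IsHodge β)
    (h : univ.val.map γ = univ.val.map α + univ.val.map β) : IsHodge γ :=
  (isHodge_iff_isHodgeMultiset γ).2 (h ▸ hα.isHodgeMultiset.add hβ.isHodgeMultiset)

/-- **Cancellation on the right factor**: if `γ ∼ α∗β` with `γ ∈ 𝔅` and `α ∈ 𝔅`, then `β ∈ 𝔅`
(the defining conditions of `Mₘ` are additive). [cite: Shioda1979PJA, §1 (the semigroup Mₘ)] -/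
theorem IsHodge.of_map_eq_add_left (hγ : IsHodge γ) (hα : IsHodge α)
    (h : univ.val.map γ = univ.val.map α + univ.val.map β) : IsHodge β :=
  (isHodge_iff_isHodgeMultiset β).2 ((h ▸ hγ.isHodgeMultiset).of_add_left hα.isHodgeMultiset)

/-- **Cancellation on the left factor**: if `γ ∼ α∗β` with `γ ∈ 𝔅` and `β ∈ 𝔅`, then `α ∈ 𝔅`.
[cite: Shioda1979PJA, §1 (the semigroup Mₘ)] -/
theorem IsHodge.of_map_eq_add_right (hγ : IsHodge γ) (hβ : IsHodge β)
    (h : univ.val.map γ = univ.val.map α + univ.val.map β) : IsHodge α :=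
  hγ.of_map_eq_add_left (β := α) hβ (by rw [h, add_comm])

end Bookkeeping

/-- In the setting of Thm. 1-4 (ii) — `α ∈ 𝔅^{2r}ₘ`, `δ ∈ 𝔇ₘ` (all `δᵢ ≠ 0`, paired), `γ ∼ α∗δ` — the
juxtaposition `γ` is a Hodge character of `X^{2(r+t+1)}ₘ` (`𝔇ₘ ⊂ 𝔅ₘ`: `IsPaired.isHodge`; then
`Mₘ + Mₘ ⊆ Mₘ`), the standing hypothesis "`α ∈ 𝔅ʳₘ, β ∈ 𝔅ˢₘ`" of Thm. 1-4 under which `V(α∗δ)` is an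
eigenLINE. [cite: Aoki1987, Thm. 1-4 (p. 388) and §1 p. 386 (`𝔇ⁿₘ ⊂ 𝔅ⁿₘ`)] -/
theorem isHodge_of_juxtaposition_paired {r t : ℕ} [NeZero m]
    {α : Fin (2 * r + 2) → ZMod m} {δ : Fin (2 * t + 2) → ZMod m}
    {γ : Fin (2 * (r + t + 1) + 2) → ZMod m} (hα : IsHodge α) (hδ0 : ∀ i, δ i ≠ 0)
    (hδ : IsPaired δ) (h : univ.val.map γ = univ.val.map α + univ.val.map δ) : IsHodge γ :=
  hα.of_map_eq_add (hδ.isHodge hδ0) h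

/-- **`claim` depends only on the character up to permutation** (iff form of the tree's
`Claim.of_univ_val_map_eq`): if `α ∼ β` (same multiset of values) then `claim(α) ↔ claim(β)`.
[cite: Aoki1987, §1 p. 386 (α ∼ β)] -/
theorem claim_congr_of_map_eq {r : ℕ} [NeZero m] {α β : Fin (2 * r + 2) → ZMod m}
    (h : univ.val.map α = univ.val.map β) : Claim m r α ↔ Claim m r β :=
  ⟨Claim.of_univ_val_map_eq h.symm, Claim.of_univ_val_map_eq h⟩

/-! ### The literal paired characters `(a₀, …, a_t, -a₀, …, -a_t)` of `𝔇ₘ` -/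

section Pairs

variable {t : ℕ}

/-- `2t + 2 = (t + 1) + (t + 1)`: the coordinates of `X²ᵗₘ` split into two halves. [folklore] -/
theorem two_mul_add_two_eq_add (t : ℕ) : 2 * t + 2 = (t + 1) + (t + 1) := by ring

/-- The splitting `Fin (2t+2) ≃ Fin (t+1) ⊕ Fin (t+1)` of the index set into its two halves
(`i ↦ inl i` for `i ≤ t`, `i ↦ inr (i - t - 1)` for `i > t`). [folklore] -/
def halves (t : ℕ) : Fin (2 * t + 2) ≃ Fin (t + 1) ⊕ Fin (t + 1) :=
  (finCongr (two_mul_add_two_eq_add t)).trans finSumFinEquiv.symm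

/-- **The literal paired character `pairs a = (a₀, …, a_t, -a₀, …, -a_t)` of `X²ᵗₘ`** attached to
`a = (a₀, …, a_t)`: Aoki's elements `(a₀, -a₀, …, a_t, -a_t)` of `𝔇²ᵗₘ` up to the evident
permutation of the coordinates (`𝔇ₘ` is defined up to `∼`, p. 386; for `aᵢ ≠ 0` these index the
linear subspaces of Thm. 1-1). [cite: Aoki1987, §1 p. 386 (definition of 𝔇ⁿₘ)] -/
def pairs (a : Fin (t + 1) → ZMod m) : Fin (2 * t + 2) → ZMod m :=
  Sum.elim a (-a) ∘ halves t

/-- The multiset of values of a function on a sum type splits. [folklore] -/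
theorem univ_val_map_sum_elim {X Y Z : Type*} [Fintype X] [Fintype Y] (f : X → Z) (g : Y → Z) :
    (univ : Finset (X ⊕ Y)).val.map (Sum.elim f g) = univ.val.map f + univ.val.map g := by
  rw [← Finset.univ_disjSum_univ, Finset.val_disjSum]
  unfold Multiset.disjSum
  rw [Multiset.map_add, Multiset.map_map, Multiset.map_map, Sum.elim_comp_inl, Sum.elim_comp_inr]

/-- **The multiset of values of `pairs a` is that of `a` plus that of `-a`.** [folklore] -/
theorem univ_val_map_pairs (a : Fin (t + 1) → ZMod m) :
    univ.val.map (pairs a) = univ.val.map a + univ.val.map (-a) := by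
  rw [pairs, ← Multiset.map_map, Multiset.map_univ_val_equiv, univ_val_map_sum_elim]

/-- `pairs a` on the first half: `aᵢ`. [folklore] -/
theorem pairs_apply_of_eq_inl {a : Fin (t + 1) → ZMod m} {i : Fin (2 * t + 2)} {k : Fin (t + 1)}
    (h : halves t i = Sum.inl k) : pairs a i = a k := by
  simp [pairs, h]

/-- `pairs a` on the second half: `-aᵢ`. [folklore] -/
theorem pairs_apply_of_eq_inr {a : Fin (t + 1) → ZMod m} {i : Fin (2 * t + 2)} {k : Fin (t + 1)}
    (h : halves t i = Sum.inr k) : pairs a i = -a k := by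
  simp [pairs, h]

/-- **`pairs a` is a paired character**: the fixed-point-free involution exchanging the two halves
(`i ↦ i + t + 1`, `i + t + 1 ↦ i`) carries it to its negative. [cite: Aoki1987, §1 p. 386 (𝔇ⁿₘ)] -/
theorem isPaired_pairs (a : Fin (t + 1) → ZMod m) : IsPaired (pairs a) := by
  refine ⟨(halves t).trans ((Equiv.sumComm _ _).trans (halves t).symm), fun i h ↦ ?_, fun i ↦ ?_,
    fun i ↦ ?_⟩
  · -- no fixed points: `swap (halves i) ≠ halves i`
    have h' := congrArg (halves t) h
    simp only [Equiv.trans_apply, Equiv.apply_symm_apply, Equiv.sumComm_apply] at h'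
    cases hi : halves t i with
    | inl k => rw [hi] at h'; exact Sum.inr_ne_inl h'
    | inr k => rw [hi] at h'; exact Sum.inl_ne_inr h'
  · simp
  · simp only [pairs, Function.comp_apply, Equiv.trans_apply, Equiv.apply_symm_apply,
      Equiv.sumComm_apply]
    cases halves t i with
    | inl k => simp
    | inr k => simp

/-- All coordinates of `pairs a` are non-zero when all `aᵢ` are. [cite: Aoki1987, §1 p. 386 (aᵢ ∈ ℤ/m - {0})] -/
theorem pairs_ne_zero {a : Fin (t + 1) → ZMod m} (ha : ∀ k, a k ≠ 0) (i : Fin (2 * t + 2)) :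
    pairs a i ≠ 0 := by
  simp only [pairs, Function.comp_apply]
  cases halves t i with
  | inl k => simpa using ha k
  | inr k => simpa using ha k

/-- **Every paired character is `∼` a literal one**: if `δ ∘ σ = -δ` for a fixed-point-free
involution `σ` of the `2t + 2` indices (`IsPaired δ`), then `δ ∼ pairs a` — the multiset of values of
`δ` is that of `(a₀, …, a_t, -a₀, …, -a_t)` — for some `a`. Proof: the indices `S = {i | i < σ i}`
meet every `σ`-orbit `{i, σ i}` exactly once, so `i ↦ i` on `S` and `i ↦ σ i` off `S` give
`Fin (2t+2) ≃ S ⊕ S` under which `δ = (δ|_S, -δ|_S)`; in particular `#S = t + 1`, and `a = δ|_S`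
enumerated. [cite: Aoki1987, §1 p. 386 ("α ∼ (a₀, -a₀, …, a_r, -a_r)")] -/
theorem IsPaired.exists_pairs {δ : Fin (2 * t + 2) → ZMod m} (hδ : IsPaired δ) :
    ∃ a : Fin (t + 1) → ZMod m, univ.val.map δ = univ.val.map (pairs a) := by
  classical
  obtain ⟨σ, h1, h2, h3⟩ := hδ
  -- representatives of the `σ`-orbits
  set S : Finset (Fin (2 * t + 2)) := {i | i < σ i} with hS
  have hmemS : ∀ {i}, i ∈ S ↔ i < σ i := by simp [hS]
  have hσS : ∀ {i}, i ∉ S → σ i ∈ S := by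
    intro i hi
    rw [hmemS, not_lt] at hi
    rw [hmemS, h2]
    exact lt_of_le_of_ne hi (h1 i)
  have hSσ : ∀ {i}, i ∈ S → σ i ∉ S := by
    intro i hi
    rw [hmemS] at hi
    rw [hmemS, h2, not_lt]
    exact hi.le
  -- `Fin (2t+2) ≃ S ⊕ S`
  let E : Fin (2 * t + 2) ≃ S ⊕ S :=
    { toFun := fun i ↦ if hi : i ∈ S then Sum.inl ⟨i, hi⟩ else Sum.inr ⟨σ i, hσS hi⟩
      invFun := Sum.elim (fun s ↦ (s : Fin (2 * t + 2))) (fun s ↦ σ s)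
      left_inv := fun i ↦ by
        by_cases hi : i ∈ S
        · simp [hi]
        · simp [hi, h2]
      right_inv := by
        rintro (s | s)
        · simp [s.2]
        · simp [hSσ s.2, h2] }
  have hδE : δ = Sum.elim (fun s : S ↦ δ s) (fun s : S ↦ -δ s) ∘ E := by
    funext i
    by_cases hi : i ∈ S
    · simp [E, hi]
    · simp only [E, Function.comp_apply, Equiv.coe_fn_mk, hi, dite_false, Sum.elim_inr]
      calc δ i = δ (σ (σ i)) := by rw [h2]
        _ = -δ (σ i) := h3 (σ i)
  -- `#S = t + 1`
  have hcard : Fintype.card S = t + 1 := by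
    have h := Fintype.card_congr E
    rw [Fintype.card_fin, Fintype.card_sum] at h
    omega
  let f : Fin (t + 1) ≃ S := (Fintype.equivFinOfCardEq hcard).symm
  refine ⟨fun k ↦ δ (f k), ?_⟩
  have hneg : (-fun k ↦ δ (f k)) = (fun s : S ↦ -δ s) ∘ f := by
    funext k; simp
  rw [univ_val_map_pairs, hneg, show (fun k ↦ δ (f k)) = (fun s : S ↦ δ s) ∘ f from rfl,
    ← Multiset.map_map, Multiset.map_univ_val_equiv, ← Multiset.map_map (fun s : S ↦ -δ s),
    Multiset.map_univ_val_equiv, ← univ_val_map_sum_elim]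
  conv_lhs => rw [hδE, ← Multiset.map_map, Multiset.map_univ_val_equiv]

end Pairs

end FermatCharacter

/-! ### Thm. 1-4 (ii): the rendering up to permutation versus the printed letter -/

/-- **The tree's `Aoki1987_claim_of_claim_juxtaposition_paired` follows from the printed letter of
Thm. 1-4 (ii)** — "if claim(`α∗δ`) is true for some `δ = (a₀, -a₀, …, a_t, -a_t)`, all `aᵢ ≠ 0`,
then claim(`α`) is true", with the literal juxtaposition `FermatCharacter.append` and the literal
paired characters `FermatCharacter.pairs`. For `δ` paired and `γ ∼ α∗δ` as in the rendering:
`δ ∼ pairs a` (`IsPaired.exists_pairs`, all `aᵢ ≠ 0` since they are values of `δ`), so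
`γ ∼ append α (pairs a)` and claim(`γ`) gives claim(`append α (pairs a)`) because claim depends
only on the multiset of values (`FermatCharacter.Claim.of_univ_val_map_eq`: the coordinate
permutations are automorphisms of `Xⁿₘ`), whence claim(`α`) by the letter. The letter (Shioda's
inductive structure read backwards, module docstring) is NOT discharged here.
[cite: Aoki1987, Thm. 1-4 (ii) (p. 388) and §1 p. 386 (𝔇ⁿₘ, α ∼ β)] -/
theorem Aoki1987_claim_of_claim_juxtaposition_paired_of_literal
    (h : ∀ (m r t : ℕ) [NeZero m] (α : Fin (2 * r + 2) → ZMod m) (a : Fin (t + 1) → ZMod m),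
      FermatCharacter.IsHodge α → (∀ k, a k ≠ 0) →
      FermatCharacter.Claim m (r + t + 1) (FermatCharacter.append α (FermatCharacter.pairs a)) →
        FermatCharacter.Claim m r α) :
    Aoki1987_claim_of_claim_juxtaposition_paired := by
  intro m r t _ α δ γ hα hδ0 hδ hγ hclaim
  obtain ⟨a, ha⟩ := hδ.exists_pairs
  have ha0 : ∀ k, a k ≠ 0 := by
    intro k hk
    have hmem : a k ∈ univ.val.map δ := by
      rw [ha, FermatCharacter.univ_val_map_pairs]
      exact Multiset.mem_add.mpr (Or.inl (Multiset.mem_map_of_mem _ (Finset.mem_univ_val k)))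
    obtain ⟨i, -, hi⟩ := Multiset.mem_map.mp hmem
    exact hδ0 i (hi.trans hk)
  refine h m r t α a hα ha0 (FermatCharacter.Claim.of_univ_val_map_eq ?_ hclaim)
  rw [FermatCharacter.univ_val_map_append, hγ, ha]

/-- **Conversely, the rendering contains the printed letter**: instantiate it at the literal
`δ = pairs a ∈ 𝔇ₘ` (`isPaired_pairs`, `pairs_ne_zero`) and the literal juxtaposition
`γ = append α (pairs a)` (`univ_val_map_append`). So the tree's rendering of Thm. 1-4 (ii) and its
printed letter are equivalent. [cite: Aoki1987, Thm. 1-4 (ii) (p. 388)] -/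
theorem Aoki1987_claim_of_claim_juxtaposition_paired.literal
    (h : Aoki1987_claim_of_claim_juxtaposition_paired) (m r t : ℕ) [NeZero m]
    (α : Fin (2 * r + 2) → ZMod m) (a : Fin (t + 1) → ZMod m) (hα : FermatCharacter.IsHodge α)
    (ha : ∀ k, a k ≠ 0)
    (hc : FermatCharacter.Claim m (r + t + 1) (FermatCharacter.append α (FermatCharacter.pairs a))) :
    FermatCharacter.Claim m r α :=
  h m r t α (FermatCharacter.pairs a) (FermatCharacter.append α (FermatCharacter.pairs a)) hα
    (FermatCharacter.pairs_ne_zero ha) (FermatCharacter.isPaired_pairs a)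
    (FermatCharacter.univ_val_map_append α (FermatCharacter.pairs a)) hc

/-! ### Dimension zero -/

/-- **Thm. 1-4 (ii) in dimension `r = 0`** (conclusion on `X⁰ₘ`): the slice `r = 0` of
`Aoki1987_claim_of_claim_juxtaposition_paired` holds because every class on `X⁰ₘ` is algebraic
(`algebraicClasses _ 0 = ⊤`, the tree's `FermatCharacter.claim_zero`), for every `t`, `δ`, `γ`.
The slices `r ≥ 1` are the inductive structure read backwards (module docstring) and are NOT
proved here. [cite: Aoki1987, Thm. 1-4 (ii), p. 388] -/
theorem Aoki1987_claim_of_claim_juxtaposition_paired_dim_zero (m t : ℕ) [NeZero m]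
    (α : Fin (2 * 0 + 2) → ZMod m) (δ : Fin (2 * t + 2) → ZMod m)
    (γ : Fin (2 * (0 + t + 1) + 2) → ZMod m) (_hα : FermatCharacter.IsHodge α) (_hδ0 : ∀ i, δ i ≠ 0)
    (_hδ : FermatCharacter.IsPaired δ) (_h : univ.val.map γ = univ.val.map α + univ.val.map δ)
    (_hγ : FermatCharacter.Claim m (0 + t + 1) γ) : FermatCharacter.Claim m 0 α :=
  FermatCharacter.claim_zero m α

end Literature.AlgebraicGeometry.HodgeTheory

end
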